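import Summits.BirchSwinnertonDyer.Rank1Residual.Additive.WildThreeQuaternionicTransfer
import HarnessLib
import HarnessLib.Audit.Tags

/-!
# O6 — THE NON-SPLIT HEEGNER FIELD: TAMAGAWA CANCELLATION AT ADDITIVE PRIMES (target `T-O6-R6`)
# (cell `b2b-bsdres`, team o5o6, seat O6-planner-2 "non-Iwasawa side", GEN 6; a TARGET
# FORMULATION — `def … : Prop` only, NOTHING asserted about curves; the `theorem`s are `omega`
# bookkeeping fixing the SHAPE in which the target is used, and one necessary-condition avatar)

HONEST FRAMING (cell `b2b-bsdres`, run/shared/lean/b2b/bsd-rank1-residual/, verbatim in every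
file): the goal of the cell is to DELETE the COMBINATION-SHAPED residual classes of the
Birch–Swinnerton-Dyer formula for ALL analytic-rank `≤ 1` elliptic curves over `ℚ` — assembled
STRICTLY from published theorems — so that the rank-`≤ 1` remainder becomes exactly the
CONSTRUCTION-SHAPED classes, which are TYPED (missing-input `Prop`s), NOT attempted. This is not
"finishing BSD". Research routes; no claim beyond stated classes; census output = EVIDENCE /
conjecture items, never a Literature fact. NOTHING below is asserted — `def … : Prop` only.

## Where gen 5 stopped (file `WildThreeQuaternionicTransfer.lean`) and the gen-6 lever

Gen 5 moved the MULTIPLICATIVE Tamagawa-`3` primes of `E` into the quaternion algebra (`D` = an even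
set of `q ∥ N` made INERT in the auxiliary imaginary quadratic `K''`): over an inert multiplicative
`q` the Gross–Zagier formula on `X₀^D(M)` carries the degree ratio `δ_{1,N}/δ_{D,M}`, which by
Ribet–Takahashi EQUALS `∏_{q∣D} c_q(E/K''_q)` up to Eisenstein primes ("the Tamagawa factors at `N⁻`
exactly cancel", W. Zhang 2014 p. 233), so those primes DISAPPEAR from the index identity; the `3`-adic
exactness of that ratio is `T-O6-R5`. What survived, **R-O6-5′** (`1 521` rank-1 / `552` rank-0 wild
classes, `N < 5·10⁵`; tame shadow `465 / 214`), are the classes with `≥ 2` ADDITIVE Tamagawa-`3` primes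
among `{3} ∪ A3` (`A3` = primes `q ≠ 3` of Kodaira type IV/IV* with `c_q = 3`), because an additive prime
cannot be put into `D` (Ribet–Takahashi / Jacquet–Langlands transfer at `q` needs `q ∥ N`).

GEN-6 LEVER — **make the additive Tamagawa-`3` primes NON-SPLIT in the Heegner field** and use the
GENERAL Gross–Zagier formula of Yuan–Zhang–Zhang in the explicit form of Cai–Shu–Tian 2014, Thm. 1.5
(held: arXiv:1408.1733, pp. 5–7), which has NO Heegner hypothesis: for `(E, K, χ = 1)` it reads
`L'(E/K,1) = 2^{-#Σ_D} · 8π²(φ,φ)_{Γ₀(N)} / (u₁² √|D_K|) · ĥ_K(y_K(f_U)) / deg f_U`, where the Heegner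
point `y_K(f_U) = Tr_{H_K/K} f_U(P)` lives on the Shimura curve `X_U` of level `U = R̂^×` for an
ADMISSIBLE ORDER `R` of the (Tunnell–Saito) quaternion algebra `𝔹`: reduced discriminant `N` and
`R_q ∩ K_q = O_{K,q}` at every `q ∣ N` non-split in `K` (CST §1.2, p. 6: `Σ₁ = {v ∣ N nonsplit in K}`;
Euler factors are removed only at `Σ = {v ∣ (N, D_K) : v² ∣ N}`, which is harmless at additive primes
since `L_v(E,s) = 1` there). At an INERT additive prime `q` with `f_q = ord_q N = 2k` even, `𝔹_q = M₂(ℚ_q)`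
and `R_q = O_{K,q} + q^k M₂(ℤ_q)`, i.e. `U_q = ℤ_{q²}^× · (1 + q^k M₂(ℤ_q))` = the NON-SPLIT CARTAN level
structure of level `q^k` (so `X_U` is the non-split Cartan modular curve at `q`; Kohen–Pacetti 2016,
"Heegner points on Cartan non-split curves", held galaxy-pdf-2208224092109269960: for odd `q`,
`q² ∥ N`, they construct these points, prove they form a HEEGNER SYSTEM (Prop. 4.6) and deduce Kolyvagin's
rank-one/finiteness theorem (Thm. 4.7) and the GZ non-torsion criterion (Thm. 4.8); Chen–Edixhoven:
`Jac(X_ns(q)) ∼ Jac(X₀(q²))^{q-new}`, their Thm. 1.12); at `f_q` odd the prime `q` joins the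
ramification set of `𝔹` (division side; needs a partner non-split prime to keep `𝔹` indefinite).

THE DICTIONARY (why non-split helps). Over any quadratic `K`, `Res_{K/ℚ} E ∼ E × E^{d_K}` and BSD is
isogeny-invariant, so the Tamagawa defect of the Kolyvagin bound over `K` is
`t_K = Σ_{w∣N} ord₃ c_w(E/K_w) = Σ_q [ord₃ c_q(E) + ord₃ c_q(E^{d_K})]`. At a SPLIT `q`: `2·ord₃ c_q(E)`.
At an INERT IV/IV* prime `q` (unramified twist: Kodaira type kept, Frobenius on `Φ_q ≅ ℤ/3` NEGATED):
EXACTLY ONE of `c_q(E), c_q(E^{d_K})` equals `3`, so the contribution is `1 = ord₃ #Φ_q(𝔽_{q²}) =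
ord₃ c_w(E/K_w)`, ALWAYS (whether `c_q(E)` is `3` or `1`; tree: the Kodaira type transports and
`c_w ∈ {1,3}` by `Literature.NumberTheory.DiophantineGeometry.localTamagawaNumber_baseChange_of_kodairaSymbolAt_eq_IV`
/ `…_eq_IVstar` (p258906); `c_w = 3` over the quadratic unramified extension is Tate's algorithm,
EVIDENCE kit:j128105 of cc-typer-5). At a RAMIFIED IV/IV* prime `q ≥ 5`
(`E^{d_K}` is II*/II there): contribution `ord₃ c_q(E)`. So over a `K` inert at `q` the prime costs `1`
instead of `2` — and, exactly as for Ribet–Takahashi, the GZ formula over such `K` carries the DEGREE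
RATIO `δ_{1,N}/δ_U` (`δ_U` = minimal degree of a parametrisation of the class by `X_U`), which appears on
the INDEX side of the BSD-shaped identity (W. Zhang 2014 Lemma 10.1 shape):
  `2·ord₃[E(K):ℤ y_K(f_U)] + ord₃(δ_{1,N}/δ_U) = ord₃ #Ш(E/K) + t_K`   (Manin/`u_v` constants `3`-units).
**T-O6-R6 (NonsplitTamagawaCancellationAtThree)** is the assertion that the RT pattern persists at EVERY
non-split bad prime:  `ord₃(δ_{1,N}/δ_U) = Σ_{q ∣ N, q non-split in K} ord₃ c_w(E/K_w)`  for `E[3]`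
irreducible — so that the index identity collapses to `2·ord₃[E(K):ℤ y_K] = ord₃ #Ш(E/K) + Σ_{w SPLIT} ord₃ c_w`
and the non-split primes' Tamagawa numbers never enter the Kolyvagin defect (`nonsplitIndexIdentity` below).
PARITY CHECK (necessary, passed): `#Ш(E/K)` is a square and `t_{split}` is even, so the identity forces
`ord₃(δ_{1,N}/δ_U) ≡ Σ_{nonsplit} ord₃ c_w (mod 2)`; with exactly one non-split bad prime, an inert IV/IV*
one, the right side is `1`, so `ord₃(δ_{1,N}/δ_U)` is ODD — "no interaction" (`= 0`) is impossible and `1` is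
the Ribet–Takahashi value.

## EVIDENCE (labels; nothing here is a Literature fact)

* **R6a — THE CASE `q = 2` IS LEMMA-LEVEL.** `4 ∥ N` ⟺ `f₂ = 2` ⟺ tame at `2` ⟺ `e = 3` ⟺ Kodaira
  IV/IV* at `2` (`Φ₂ ≅ ℤ/3`), `π₂` = depth-zero supercuspidal (no cubic characters of `ℚ₂^×`), and in the
  Bruhat–Tits tree at `2` the group `U₂ = ℤ₄^×(1 + 2M₂(ℤ₂))` is the stabiliser of a vertex acting on its
  THREE neighbours through `A₃`, while `K₀(4)` (conjugate to `K(2)`) is the pointwise stabiliser: `U₂ ⊃ K₀(4)`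
  with index `3`, `U₂/K₀(4) ≅ ℤ/3`. Hence `X₀(N) → X_U` is a cyclic Galois cover of degree `3`
  (`ρ = w₄ ∘ (z ↦ z + ½)`, order `3` in `PSL₂`), the newform of `E` (multiplicity one; `σ = π₂^{K(2)}` is the
  sign character of `GL₂(𝔽₂) ≅ S₃`, trivial on `A₃`) is `ρ`-invariant, `E` is a quotient of `J_U`, and
  composing the optimal `X_U`-parametrisation with the cover gives `deg(λ)·δ_{1,N} = 3·δ_U` for an isogeny
  `λ : E₁ → E_U` inside the class; with no rational `3`-isogeny `3 ∤ deg λ`, so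
  `ord₃(δ_{1,N}/δ_U) = 1 = ord₃ c_w(E/K_w)` EXACTLY — T-O6-R6 at `q = 2`. Necessary avatar
  **F-R6-a**: `3 ∣ δ_{1,N}` whenever `4 ∥ N` and the class has no rational `3`-isogeny — CENSUS (Cremona
  `alldegphi`, every curve with `N < 5·10⁵`, 2026-08-21, `gen6/o6r2g6_r6_census.py`): **`184 342 / 184 342`**
  (`27 ∤ N`: `170 760`; `27 ∣ N`: `13 582`); in classes WITH a rational `3`-isogeny `31 278 / 31 306`, the
  `28` exceptions (`20a1` `deg 1`, `36a1`, `44a1`, `92a1`, …) being exactly the `3 ∣ deg λ` escape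
  (`20a1 = X₀(20) → X₀(20)/⟨ρ⟩ = E_U` IS a `3`-isogeny: `δ_{1,20} = δ_U = 1`, `deg λ = 3`).
  Typed below as `ThreeDvdModularDegreeOfFourExact` (a `Prop`; proof = the sketch above, modular curves
  needed, not in Mathlib).
* **R6-lit121 — AN EXACT PRINTED INSTANCE AT AN ODD CARTAN PRIME (`q = 11`, `N = 121`, `M = 1`,
  `X_U = X_ns(11)`).** Fernández–González 2015 (Math. Comp.; arXiv:1411.6639 §3, Thm. 3.1) and
  Dose–Fernández–González–Schoof 2014 (arXiv:1403.6254 Prop. 2) give morphisms `X_ns(11) → E` of degrees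
  `6, 2, 2, 6` onto `121a1, 121b1, 121c1, 121d1`, each an OPTIMAL quotient of `J_ns(11)` (so these are the
  class-minimal degrees `δ_ns`), while Cremona's `δ_{1,121} = 6, 4, 6, 24`. Kodaira types at `11` (from
  `ord₁₁ Δ_min = 2, 3, 4, 7`): II, III, IV, I₁*, so `#Φ₁₁(𝔽_{121}) = 1, 2, 3, 4`. Hence
  **`δ_{1,N}/δ_ns = 1, 2, 3, 4 = #Φ_q(𝔽_{q²})` EXACTLY in all four classes** — the Ribet–Takahashi identity
  `δ₁/δ_q = #Φ_q` transplanted verbatim to a Cartan prime, integrally; in particular T-O6-R6 holds at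
  `(121c, q = 11)`: `ord₃(6/2) = 1 = ord₃ c_w` (type IV, `E[3]` irreducible), and at its quadratic twist
  `121a` (type II, SAME `δ₁ = 6`): `ord₃(6/6) = 0 = ord₃ c_w` — the discriminating pair that `δ_{1,N}` alone
  cannot see (O-R6-deg below). Neither paper remarks the ratio; DFGS Remark 2 records "no a priori reason"
  for their degree-`3` maps `H → 121a, 121d` — under T-O6-R6⁺ they are forced (`δ_ns = δ₁/#Φ = 6 = 2·3`).
  STRONG FORM suggested by this: **T-O6-R6⁺ (Cartan–Ribet–Takahashi)**: for odd `q`, `q² ∥ N`: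
  `δ_{1,N}/δ_{ns,q} = #Φ_q(E)(𝔽_{q²})` up to primes `p` with `E[p]` reducible (`49a`: `X_ns(7) ≅ 49a2`,
  ratio `1` vs `#Φ_{III} = 2`, `2` Eisenstein). EVIDENCE, `1` level; census-cell test F-R6-c extends it.
* **R6-mult — the multiplicative non-split case IS Ribet–Takahashi** (`T-O6-R5`, gen 5; proved case R5a;
  census F-R5-deg `0 / 1 021 838`).
* **R6b — odd `q ≥ 5`, `q² ∥ N`, inert (conjectural).** Printed antecedents: CST Thm. 1.5 (GZ), Kohen–Pacetti
  2016 (Heegner system on `X_ns`, Kolyvagin; Manin constant of the Cartan parametrisation `∈ ℤ[1/q]` in all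
  their examples, Table 1: `1/11, 1, 1/17, 1/7, 1/7` — so `3`-adically harmless for `q ≠ 3`, their Conj. 2.3),
  Chen–Edixhoven, and Longo–Rotger–de Vera-Piquero 2018 (Publ. Mat. 62; held doi:10.5565/publmat6221803):
  the explicit Shimura curves `X_R` for orders of type `(N_Eic; N_Car; {(L_p, ν_p)}_{p∣Δ})` (their Def. 1.3 —
  non-split CARTAN orders of level `q^ν` at `q ∣ N_Car`, Hijikata–Pizer–Shemanske orders `O_{L_p} + ϖ^{ν-1}O_p`
  at division primes; level `N_Eic N_Car² N_Δ`), the Jacquet–Langlands lift of `f` to `R_min` (Prop. 2.8: at a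
  division prime with `ord_p N` odd `L_p` is UNRAMIFIED — our R6d), Heegner points of conductor `c` on `X_R` and,
  via Nekovář 2007, `L'(E/K,χ,1) ≠ 0 ⇒ dim (E(H_c) ⊗ ℂ)^χ = 1` for EVERY `(E, K, χ)` with `ε = −1` under their
  Assumption 4.9 (Thm. 4.16; for `χ = 1` and our field choices — removed primes inert, all other bad primes
  split — 4.9 (i)–(v) are satisfied or vacuous, INCLUDING `27 ∣ N`: (iv) concerns `3 ∣ N_Eic`, (v) `3`
  ramified). So the rank-one / finiteness INPUT over the non-split field is PRINTED for all tiers; the `3`-part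
  structure theorem and the degree comparison are not. The degree ratio is a finite-group object: in `J(Γ₀(N/q²) ∩ Γ(q))` the curve `E` occurs
  with multiplicity `dim σ = q ∓ 1` (`σ = π_q^{K(q)}`, cuspidal resp. induced, of `GL₂(𝔽_q)`), the lattice
  `Λ_E = Hom(J, E)` carries the positive form `f ↦ f f^∨` and a `GL₂(𝔽_q)`-action, and `δ_{1,N}`, `δ_U` are
  its values at the primitive split-torus-fixed resp. non-split-torus-fixed vectors (exactly one of the two
  tori of `PGL₂(𝔽_q)` has order divisible by `3`, the split one iff `q ≡ 1 (3)` iff `π_q` is principal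
  series). No printed comparison theorem found: no hits for "modular degree"∧"non-split Cartan"∧parametrization,
  none in `lit vsearch` ("degree of the parametrization by the non-split Cartan curve compared with the modular
  degree"), galaxy (star all) "non-split Cartan curve|nonsplit Cartan curve|Cartan non-split curve" → only
  Kohen–Pacetti and two Chabauty papers (2026-08-21); the one computed level (`121`, R6-lit121) matches. Weak
  census avatar (`3 ∣ δ_{1,N}` for IV/IV* at `q ≥ 5`):
  `148 624 / 148 624` irreducible-class curves — CONSISTENT BUT NOT DISCRIMINATING: the same run shows
  `3 ∣ δ_{1,N}` at 100 % for EVERY tame type with `e ∈ {3,6}` (II `26 481/26 481`, II* `12 836/12 836`) and for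
  all potentially multiplicative `I_n*` (`147 796/147 796`; `9 ∣ δ_{1,N}` for all `24 274` with `3 ∣ n`), but
  NOT for I₀* (`85.3 %`), III/III* (`76.7 %`) — observation **O-R6-deg** (a `3 ∣ q² − 1`-type local factor
  of the degree formula plus Ribet level-lowering on the twist; it masks the Tamagawa signal in `δ_{1,N}`
  alone). DISCRIMINATING TEST **F-R6-c** (census-cell engine ask A-O6-R6-E1): compute `δ_U` directly for the
  `R-O6-5′` curves with an odd IV/IV* prime (`4563d1` at `13`, `4725i1` at `5`, …) — modular symbols on
  `Γ_H = Γ₀(N) ∩ Γ₁(q)` (conjugate of `Γ₀(N/q²) ∩ Γ(q)`), `E`-isotypic lattice, non-split-torus-fixed line —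
  or Kohen–Pacetti's period method; prediction `ord₃ δ_U = ord₃ δ_{1,N} − 1`; ONE curve with
  `ord₃(δ_{1,N}/δ_U) ≠ 1` refutes T-O6-R6 at that `q`.
* **R6c/R6d — the prime `3` itself** (`f₃ = 4`: Cartan level `9`, `GL₂` side; `f₃ ∈ {3,5}`: division side
  with a partner) is the SAME conjecture but OUTSIDE Kohen–Pacetti (`p² ∥ N`, `p` odd) and with a genuine
  Manin-constant-at-`3` caveat (their Conj. 2.3 allows `3` in the constant when `3 ∣ N`): kept as the weakest
  tier. `27 ∣ N` always gives `3 ∣ δ_{1,N}` (`176 266/176 266`; `9 ∣ δ_{1,N}` for all `7 168` with `f₃ = 5`) —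
  observation O-R5-w of gen 5, refined, unexplained, not used.

## What T-O6-R6 does to R-O6-5′ (census `gen6/o6r2g6_r6_census.py`, PART B; EVIDENCE)

Per surplus row the additive Tamagawa-`3` primes are re-labelled: `q = 2` ↦ removable at lemma level
(R6a); odd `q ≥ 5` ↦ removable under R6b; `q = 3` with `c₃ = 3` ↦ R6c (`f₃ = 4`) / R6d (`f₃` odd, partner =
any multiplicative prime). The field `K` is then: inert at the removed primes, split at the kept ones and at
every other bad prime, `E^{d_K}` of analytic rank `0`/`1` as needed (Friedberg–Hoffstein / Bump–Friedberg–
Hoffstein with prescribed local behaviour — theorems), and the kept Tamagawa-`3` primes must number `≤ 1`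
(Jetchev max-form over such `K` = typed gap `T-O6-J^U`, the `X_U`-analogue of `T-O6-J`). RESULT
(wild, `27 ∣ N`): rank 1 `1 521 = 822 (R6a + J alone) + 699 (needs R6b/c/d: 94 R6b, 95 R6b+R6c,
400 R6b+R6d, 14 R6c, 96 R6d) + 0`; rank 0 `552 = 238 + 314 (62, 36, 131, 20, 65) + 0`; tame shadow r1
`465 = 282 + 183 (R6b)`, r0 `214 = 107 + 107`. I.e. **R-O6-6 := the R-O6-5′ rows closed by NO choice of
non-split set = ∅**, and **822 r1 / 238 r0 wild rows (54 % / 43 %) need only the lemma-level case R6a**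
(their two additive Tamagawa-`3` primes are `{3, 2}`: keep `3` split, make `2` inert) plus the typed gaps
shared with gen 4/5: Kolyvagin structure shape for the CST point over such `K` (Nekovář 2007 general-`X_U`
Euler system, acq-08433; hypothesis reading at `p = 3 ∣ N` flagged), GZ in BSD shape on `X_U`
(CST Thm. 1.5 — PRINTED), `3 ∤` Manin-type constant of `f_U` (KP Conj. 2.3: supported at the Cartan prime
`2` only), `T-O6-J^U`, and the rank-`0` twin side (unchanged). DEFINITION REQUESTS: D-O6-R6-1 = a
`CSTLevelShimuraCurveData N K S` (indefinite `𝔹` ramified at `S`, an order `R` of reduced discriminant `N`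
with `R ∩ K = O_K` at the non-split primes — NOT Eichler there — `ι`, `fd`; `ShimuraParametrizationData`
reused verbatim) so that `δ_U` and T-O6-R6 get a formal home like `RTGammaThreeUnitAt`; D-O6-R6-2 = the CST
CM point `y_K(f_U) ∈ E(K)` and Thm. 1.5 as a named-fact SHAPE.

ADDENDUM G6-8 (same day): the degree law is FINITE-GROUP LINEAR ALGEBRA — the TORIC LATTICE MODEL of §4
(`S = Sh_{K(q)K₀(M)}/Z`, `G = PGL₂(𝔽_q)`, `X₀(N) = S/T̄_s`, `X_U = S/T̄_ns`, `Λ_E = Hom(J_S, E) ⊂ σ = π_q^{K(q)}`,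
`δ_Y = λ_Y² Q(v_Y)/|T̄_Y|`): model identity `(q+1)Q(v_s) = #Φ_q(𝔽_{q²})(q−1)Q(v_ns)` verified exactly for all
supercuspidal `q ≡ 2 (3)`, `q ≤ 71` (unique lattice class) and the two-class dichotomy `∓1` for `q ≡ 1 (3)`,
`q ≤ 43` (class forced by level-lowering under surjective `ρ̄_{E,3}`); `q = 5` decided by the kernel in
`ToricLawAtFive`.  Tiers R6a/R6b become lemma-level-by-sketch; the census residual needing a CONJECTURAL tier
drops to the `208` rows (`122` r1 + `86` r0, all wild) that need `q = 3` itself (R6c/R6d); tame shadow `0`.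

Antecedents (EVIDENCE labels; PDF pages of the materialised texts): [corpus:paper:arxiv-1408.1733 p0002
(Thm. 1.1, `c₁ = 1` case), p0005–p0007 (Thm. 1.5; `Σ, Σ_D, Σ₁`; admissible orders `R ∩ K̂ = Ô_{c₁}`,
discriminant `N`; `(f₁,f₂)_{R^×} = deg f`; special cases 1–2)]; [corpus:paper:galaxy-pdf-2208224092109269960
p0001 (abstract: odd `p`, `p² ∥ N`, `p` inert), p0013 (Thm. 1.12 Chen–Edixhoven), p0028 (Conj. 2.3 Manin
constant `∈ ℤ[1/N]`), p0032–p0034 (Def. 4.5, Prop. 4.6 Heegner system, Thm. 4.7 Kolyvagin, Thm. 4.8 GZ–Zhang),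
p0036 (Table 1 Manin constants)]; [corpus:paper:doi-10-4310-cjm-2014-v2-n2-a2 p0043, p0054–p0055 (W. Zhang
2014: Tamagawa cancellation at `N⁻`, Lemma 10.1)]; [corpus:paper:doi-10-5565-publmat6221803 p0004 (Thm. A),
p0008–p0009 (§1.2, Def. 1.3: Eichler/Cartan/HPS local orders, level `N_Eic N_Car² N_Δ`), p0014 (Prop. 2.8, local
types of the JL lift), p0029–p0030 (Assumption 4.9), p0036–p0037 (Thm. 4.16, Defs. 4.17–4.18, Cor. 4.19)];
[corpus:paper:arxiv-1411.6639 p0010–p0011 (degrees `6,2,2,6`, optimality, Thm. 3.1 `J₀(121)^new ≅ J_ns(11)`,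
kernel of `J_ns(11) → ∏E` is `(ℤ/2)⁴ × (ℤ/3)²`)]; [corpus:paper:arxiv-1403.6254 p0006 (Prop. 2, Remark 2)];
[corpus:paper:arxiv-1911.09446 p0003 (Česnavičius–Neururer–Saha Thm. 1.2: `v₃(c_φ) ≤ v₃(deg φ)`, `+1` if
`27 ∣ N` and no `p' ≡ 2 (3)` divides `N` — so the classical Manin `3`-unit gap is NOT closed by it on `27 ∣ N`,
where `3 ∣ deg φ` always)]; gen-5 antecedents for the multiplicative case as in
`WildThreeQuaternionicTransfer.lean`; Nekovář 2007 NOT held (acq-08433; it is [Nek1] of LRdVP); Kohen–Pacetti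
2018 (TAMS 370, additive primes RAMIFYING in `K`) NOT held — galaxy (star all) "additive reduction
ramifying|Heegner point constructions and fundamental|Cartan level structure" → no relevant hits (2026-08-21).

## TYPER PLACEMENT NOTE (cc-typer-5 GEN 4, typer of record O5 §3.5 / O6 §3.4, 2026-08-21)
Re-land (ASK A-O6-J9b) from o6-r2 GEN 6's file `HOME/b2b-bsdres-o6-r2/gen6/WildThreeNonsplitTransfer.lean`
sha16 82640b8549bc036b (supersedes the first landing p261003 = 5f103e13e0f84e77: adds §4 `ToricLawAtFive`
and the G6-8 docstring addendum; no previously landed declaration removed or re-stated) VERBATIM below this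
note except lint-only `[folklore]` docstrings on the §4 bookkeeping declarations that had none (gate
`lint.docstring`; no declaration changed). TYPER READING (unchanged from p261003, AGREED by o6-r2 10:31Z):
(i) the `@[conjecture]` node `NonsplitTamagawaCancellationAtThree` (T-O6-R6) is BY ITS AUTHOR'S DESIGN
definitionally its `q = 2` avatar `ThreeDvdModularDegreeOfFourExact` (R6a, lemma-level in print modulo
modular curves) until the Cai–Shu–Tian curve datum exists (definition request D-O6-R6-1) — a future
`_holds` discharges R6a ONLY, and the node is to be SUPERSEDED (new name, never re-worded in place) by the
`X_U`-level statement once D-O6-R6-1 lands; (ii) the `omega` theorems of §2 fix the SHAPE in which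
T-O6-R6 is consumed over natural-number valuations; (iii) §4 `ToricLawAtFive` (split into the sibling file `Additive/WildThreeToricLawAtFive.lean` by the
400-line lint) is a DECIDABLE MODEL computation in the lattice `{x : Fin 5 → ℤ | Σ x = 0}` with its `S₅ ≅ PGL₂(𝔽₅)`-action (torus-fixed
vectors and their norms) — EVIDENCE for the toric degree law's shape at `q = 5`; the identification of
this model with `Hom(J, E)` and its degree form is the (untyped) content of T-O6-R6⁺, nothing about curves
is asserted; (iv) 'c_w = 3 ALWAYS above an inert IV/IV* prime' rests on the tree's
`localTamagawaNumber_baseChange_of_kodairaSymbolAt_eq_IV` / `_eq_IVstar` (c_w ∈ {1, 3}, p258906) plus Tate's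
algorithm over the unramified quadratic extension (EVIDENCE kit:j128105). Audit marks expected:
`conjecture` 1, `vendored-fact` on the bodied `def : Prop`s (`ThreeDvdModularDegreeOfFourExact`,
`ToricLawAtFive.InStd`), `orphan` on the bookkeeping — the J8 idiom. 0 named Literature facts; census
items, never Literature facts; nothing booked; no mark of `RESIDUAL-MAP.md` moves. D-O6-R6-1/2 remain
successor definition items of this seat (not blocking).
-/

namespace Summit.BirchSwinnertonDyer.Rank1Residual.AdditiveThree

open scoped Classical
open Literature.NumberTheory.Automorphic
open Literature.NumberTheory.EllipticCurves.ModularForms (ModularParametrizationData IsNewformOf)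
open WeierstrassCurve

/-! ## §1. The lemma-level case `q = 2` as a checkable avatar (F-R6-a) -/

/-- **F-R6-a / R6a avatar — `3` divides the modular degree when `4 ∥ N`.** For every elliptic `W/ℚ`
whose conductor has `ord₂ N = 2` (equivalently: Kodaira type IV or IV* at `2`) and whose mod-`3`
representation is irreducible, and every classical parametrisation datum `D₁` of level `N` carrying the
newform of `W` and of minimal degree among such (`δ_{1,N}`, the idiom of `QuaternionicTamagawaTransferAtThree`):
`3 ∣ δ_{1,N}`. PROOF SKETCH (not formalisable without modular curves): `X₀(N) → X₀(N)/⟨w₄ ∘ (z ↦ z+½)⟩ = X_U`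
is cyclic of degree `3` and `E` is a quotient of `J_U` (module docstring, R6a), so `deg λ · δ_{1,N} = 3 δ_U`
with `λ` an isogeny in the class, of degree prime to `3` under the irreducibility hypothesis.
CENSUS 2026-08-21 (Cremona `N < 5·10⁵`): `184 342 / 184 342` curves in classes without a rational
`3`-isogeny; `28` failures among `31 306` curves in classes with one (`20a1`, `36a1`, `44a1`, …). This is the
`q = 2` instance of T-O6-R6 (`ord₃(δ_{1,N}/δ_U) = 1 = ord₃ c_w(E/K_w)`, `K` inert at `2`). A predicate;
nothing asserted. [folklore] -/
def ThreeDvdModularDegreeOfFourExact : Prop :=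
  ∀ {N : ℕ} [NeZero N] (W : WeierstrassCurve ℚ) [W.IsElliptic],
    W.conductorNorm ℤ = N → N.factorization 2 = 2 → W.HasIrreducibleModPGaloisRep 3 →
    ∀ (W₁ : WeierstrassCurve ℚ) [W₁.IsElliptic] (D₁ : ModularParametrizationData W₁ N),
      IsNewformOf W D₁.f →
      (∀ (W₂ : WeierstrassCurve ℚ) [W₂.IsElliptic] (D₂ : ModularParametrizationData W₂ N),
          D₂.f = D₁.f → D₁.modularDegree ≤ D₂.modularDegree) →
      3 ∣ D₁.modularDegree

/-! ## §2. The SHAPE in which T-O6-R6 is used (bookkeeping over the `3`-adic orders; `omega`)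

All quantities are natural numbers standing for `3`-adic valuations of the objects named in the
docstrings; the hypotheses are the printed / typed inputs. Nothing is asserted about curves. -/

section Bookkeeping

variable {i sha tS tN d0 dU M : ℕ}

/-- **The non-split index identity.** Inputs: the GZ–BSD-shaped identity over `K` with the degree ratio
on the index side (`hGZ`: `2·ord₃[E(K):ℤy_K(f_U)] + ord₃ δ_{1,N} = ord₃ #Ш_an(E/K) + t_split + t_nonsplit + ord₃ δ_U`,
CST 2014 Thm. 1.5 + BSD-invariance of `Res_{K/ℚ}E ∼ E × E^{d_K}`, Manin/period constants `3`-units) and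
T-O6-R6 (`hR6`: `ord₃ δ_{1,N} = ord₃ δ_U + t_nonsplit`). Output: the non-split Tamagawa numbers are gone —
`2·ord₃[E(K):ℤy_K] = ord₃ #Ш_an(E/K) + t_split`. [folklore] -/
theorem nonsplitIndexIdentity (hGZ : 2 * i + d0 = sha + tS + tN + dU) (hR6 : d0 = dU + tN) :
    2 * i = sha + tS := by
  omega

/-- **Closing shape of a non-split pair.** With the Kolyvagin structure theorem for the CST point in the
shape `ord₃ #Ш(E/K) + 2 M_∞ = 2·ord₃[E(K):ℤy_K]` (`hS`; Nekovář 2007 / `KolyvaginStructureThreeShape`-type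
typed gap over `X_U`), the GZ identity read with the TRUE `Ш` replaced by the analytic one is BSD₃(E/K); so:
BSD₃(E/K) (`sha_true = sha_an`) holds iff `2 M_∞ = t_split`. Here: `hGZan` is the analytic identity
(definition of `ord₃ #Ш_an`), `hR6` the cancellation, `hS` the structure theorem, `hM` the divisibility
input `2 M_∞ = t_split` (Jetchev max-form suffices when at most one split Tamagawa-`3` prime is kept);
conclusion `sha_true = sha_an`. [folklore] -/
theorem shaEq_of_nonsplitCancellation {shaAn : ℕ}
    (hGZan : 2 * i + d0 = shaAn + tS + tN + dU) (hR6 : d0 = dU + tN)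
    (hS : sha + 2 * M = 2 * i) (hM : 2 * M = tS) : sha = shaAn := by
  omega

/-- **Upper-bound form** (the Euler-system direction only): structure inequality
`ord₃ #Ш(E/K) + 2 M_∞ ≤ 2·ord₃[E(K):ℤy_K]` is an equality in Kolyvagin's theorem, but the USE made of the
divisibility input is one-sided — `2 M_∞ ≥ t_split` gives `ord₃ #Ш(E/K) ≤ ord₃ #Ш_an(E/K)`. [folklore] -/
theorem shaLe_of_nonsplitCancellation {shaAn : ℕ}
    (hGZan : 2 * i + d0 = shaAn + tS + tN + dU) (hR6 : d0 = dU + tN)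
    (hS : sha + 2 * M = 2 * i) (hM : tS ≤ 2 * M) : sha ≤ shaAn := by
  omega

/-- **Why SPLIT fields cannot do this** (the gen-4/5 obstruction in the same currency): over a `K` in which
a Tamagawa-`3` prime set of total valuation `a` (counted once over `ℚ`) is split, `t_split = 2a`, and a
max-form divisibility `M_∞ = m` with `m < a` leaves the defect `2(a − m) > 0`. [folklore] -/
theorem splitDefect_pos {a m : ℕ} (hS : sha + 2 * M = 2 * i) (hM : M = m) (hlt : m < a)
    {shaAn : ℕ} (hGZan : 2 * i = shaAn + 2 * a) : shaAn + 2 ≤ sha := by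
  omega

end Bookkeeping

/-! ## §3. The target, informal home (formal home awaits D-O6-R6-1)

`T-O6-R6` quantifies over the CST test-vector curve `X_U`, for which the tree has no datum yet (its
`ShimuraCurveData D M` hard-codes an EICHLER order of level `M`; the admissible order at a non-split
additive prime is `O_{K,q} + q^k R₀`, not Eichler). Until D-O6-R6-1 lands, the target is recorded as the
docstring of the following `Prop`, whose formal content is only its lemma-level instance R6a. -/

/-! ## §4. G6-8 — the toric lattice model at `q = 5` (decidable EVIDENCE)

Placed in the sibling file `Additive/WildThreeToricLawAtFive.lean` (namespace
`AdditiveThree.ToricLawAtFive`; the 400-line lint for Summit files forced the split — typer note). -/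

/-- AMENDMENT 2 (o6-r2 GEN 7 FINAL ADDENDUM 13:41Z, memo `O6-GEN7.md` §G7-3b/3c; recorded by cc-typer-5 GEN 5 —
DOC-ONLY, statement unchanged; EVIDENCE, no new `Prop`). F-R6-c BOTH BOXES COMPLETE, superseding the interim counts
of the AMENDMENT below (270/270, 82/84, 407/420, 'level-9 rows single-seat'): prime box = ALL 3637 pairs (class,
`q`) with `q² ∥ N ≤ 5000`, `5 ≤ q ≤ 67` (kit j132107, j132130–j132132); level-`9` box = ALL 642 classes with
`81 ∥ N < 10⁴` (j131369, j131689, j131690, j132945–j132947). T-O6-R6 (`ord₃ δ_{1,N} − ord₃ δ_U = ord₃ c(E/K_w)`,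
`E[3]` irreducible): **3308/3308** (prime 2892/2892; level `9` 416/416 = PS3 94 + PS6 94 + SC3 114 + SC6 114), 0
kill candidates; `E[3]` reducible 954/971 (the 17 failures: `#E(ℚ)_tors = 3`, ratio 1 where `c_w = 3`). Strong form
(DL) `δ₁/δ_U = c(E/K_w)`: **4248/4279**, the 31 exceptions ALL Eisenstein (17 × (`c_w` 3, ratio 1, tors 3), 13 ×
(`c_w` 4, ratio 2, tors 2 or 4), 1 × (`c_w` 2, ratio 1, tors 2 = 49a1@7)); level `9` by type: PS3 146 × 1, SC3 175 ×
1, PS6 144 × 3 + 2 Eisenstein (162c1, 891f1), SC6 175 × 3 — i.e. F-R6-c at level 9: 640/642 + 2 Eisenstein. SECOND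
ENGINE: cc-eng-1 CARTDEG (j131447, Manin symbols) agrees on ALL 714 shared prime-`q` rows (`δ_ns`, `δ₁`, and
`#Φ_q(𝔽_{q²}) = c_w`); the level-`9` rows: cc-eng-1's level-9 engine `cartdeg_h` (B-22, INBOX 13:51Z, column
`class-closure/eng-1/out/cartb1/wildthree_census_second_engine.tsv` 644bb9df863b396a keyed to the landed `Row`
literals) recomputes `δ_U` on all 84 level-`9` rows with `N ≤ 2000` and the 6 rows with `N = 2025`, equal 90/90 — so
A-O6-G7-E1 (targets 162a1 `δ_U = 4`, 162d1 `12`, 324a1, 405d1, 567a1) is ANSWERED and the whole 420-row core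
`Additive/WildThreeCartanDegreeCensus.lean` is two-engine 420/420 (prime-`q` rows three-engine with cc-eng-3's
`cartdeg2` j131741); the 152 level-`9` rows with `2025 < N ≤ 5000` of the extension file stay ENGINE2-only (cc-eng-1
`jobs-level9ext` shelved, waiting list 5b). [This clause REVISED doc-only by cc-typer-5 GEN 5 the same hour as
AMENDMENT 2 landed (p277856), on cc-eng-1's 13:51Z fold; first landed text said 'single-seat (A-O6-G7-E1 still
open)'.] Table of record `HOME/b2b-bsdres-o6-r2/gen7/o6r2g7_fr6c_results.tsv` (4290 rows = 4279 non-split + 11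
controls; sha16 ca034197f3dd3d93); kernel-decided core = `Additive/WildThreeCartanDegreeCensus.lean` (420 rows,
p271478) + its level-`9` extension `Additive/WildThreeCartanDegreeCensusNine.lean` (578 rows in all = o6-r2's final
file 3e2f470dfdeac9e5, append-only form). Eisenstein is an escape clause, not an iff (1160 rows with `2 ∣ tors` and
`2 ∣ c_w`: 14 exceptions; 208 rows with `3 ∣ tors`, `3 ∣ c_w`: 17). Nothing booked; no mark moves.
AMENDMENT (o6-r2 GEN 7, ASK A-O6-G7-T2, 2026-08-21; recorded by cc-typer-5 GEN 4 — DOC-ONLY, statement unchanged;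
EVIDENCE, no new `Prop`). (1) R6c CLAUSE CORRECTED: `f₃ = 4` (`81 ∥ N`) ⇒ `E` is potentially GOOD at `3` with
`Φ = ρ_E(I₃) ∈ {C₃, C₆}` and `π₃` is ONE OF FOUR types — PS3 / PS6 (ramified principal series, `χ|ℤ₃^×` of order 3 / 6,
conductor 9) or SC3 / SC6 (unramified supercuspidal, level-2 `θ` on `ℚ₉^×`), all of conductor exactly `81` with
`dim σ^{T_s} = dim σ^{T_ns} = 1`; `w₃(E) = −1 ⟺ PS6`; `|Φ| = 3 ⟺` Kodaira II/II* and `|Φ| = 6 ⟺` IV/IV* (forced by Ogg's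
formula — the OPPOSITE of the tame dictionary), so T-O6-R6's prediction at the inert prime `3` reads
`ord₃(δ₁/δ_U) = ord₃ c(E/ℚ₉) = 1` for PS6/SC6 and `0` for PS3/SC3. CENSUS F-R6-9 (kit j131016, all 642 classes with
`81 ∥ N < 10⁴`): PS3 146 · PS6 146 · SC3 175 · SC6 175, `w₃ = −1 ⟺ PS6` 642/642. (2) F-R6-c RUN AT SCALE (o6-r2 ENGINE2 =
exact modular symbols, PARI `msfromell`/`mseval`; kernel-decided table `Additive/WildThreeCartanDegreeCensus.lean`):
`ord₃ δ_{1,N} = ord₃ (c(E/K_w)·δ_U)` on EVERY `E[3]`-irreducible row — 270/270 (tier R6b: all 336 classes with prime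
`q ∈ {5,…,31}`, `q² ∥ N ≤ 1000`; tier R6c: all 84 classes with `f₃ = 4`, `N ≤ 2000`, all four local types: PS3 18/18,
SC3 24/24 ratio 1, PS6/SC6 ratio 3 with 82/84 + 2 Eisenstein exceptions); SECOND ENGINE: cc-eng-1's Manin-symbol CARTDEG
(kit j131447) agrees on 336/336 prime-`q` rows (`δ₁` and `δ_U`); level-9 rows single-seat (A-O6-G7-E1 open).
(3) STRONG FORM T-O6-R6⁺ (DL), informal, EVIDENCE-backed (o6-r2 GEN 7 memo §G7-4; typed nowhere, no slot): for `E/ℚ`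
optimal of conductor `N = q'²M`, `(q', M) = 1`, `q' = q ≥ 5` prime or `q' = 9` with `f₃ = 4`, `X_U = X(q'; M)/T_ns`,
`δ_U` the optimal degree of the class, and every prime `p` with `E(ℚ)[p] = 0`:
`ord_p δ_{1,N} − ord_p δ_U = ord_p c(E/K_w)`, `K_w` = the unramified quadratic extension of `ℚ_q` — the additive analogue
of Ribet–Takahashi `δ₁/δ_D = ∏ c_q` with `c_q` read over `K_w`. Evidence: `δ₁/δ_U = c(E/K_w)` EXACTLY on 407/420 rows,
the 13 failures ALL Eisenstein (ratio `c_w/p`, `p ∣ #E(ℚ)_tors`; printed precedent Kohen–Pacetti Rem. 5.1: at `49a` the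
`X_ns(7)`-optimal curve is `49a2`). Presearch (o6-r2): no printed statement or proof of (DL) found (corpus hybrid
"modular parametrization degree non-split Cartan optimal quotient Tamagawa"; galaxy "non-split Cartan|nonsplit Cartan").
Mechanism still OPEN (memo W2–W5: the cokernel of `Λ^{T_s} ⊕ Λ^{T_ns} → Λ ⊗ triv` should have order `c_w` up to
Eisenstein primes). ORIGINAL DOCSTRING:
**T-O6-R6 — NON-SPLIT TAMAGAWA CANCELLATION AT `3`** (informal statement; formal avatar = its `q = 2`
instance `ThreeDvdModularDegreeOfFourExact`, pending D-O6-R6-1): for every elliptic `E/ℚ` with `E[3]`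
irreducible, every imaginary quadratic `K` with `ε(E/K) = −1`, and the Cai–Shu–Tian test-vector Shimura
curve `X_U` of `(E, K, χ = 1)` (admissible order `R`: reduced discriminant `N`, `R_q ∩ K_q = O_{K,q}` at the
`q ∣ N` non-split in `K`), with `δ_U` the minimal degree of a parametrisation of the isogeny class of `E`
by `X_U`:  `ord₃(δ_{1,N}/δ_U) = Σ_{q ∣ N, q non-split in K} ord₃ c_w(E/K_w)`.
KNOWN INSTANCES: multiplicative inert `q` (Ribet–Takahashi; `3`-exactness = T-O6-R5, proved case R5a);
`q = 2` inert with `4 ∥ N` (R6a, lemma-level, census `184 342/184 342`); `q = 11`, `N = 121`: all four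
classes satisfy `δ₁/δ_ns = #Φ₁₁(𝔽_{121})` exactly (R6-lit121, from printed degrees).
TORIC LATTICE MODEL (memo G6-8; `ToricLawAtFive` above is its `q = 5` instance, kernel-decided): with
`S = Sh_{K(q)K₀(M)}/Z`, `G = PGL₂(𝔽_q)`, `X₀(N) = S/T̄_s`, `X_U = S/T̄_ns` [Edixhoven, alg-geom/9604008 §1] and
`Λ_E = Hom(J_S, E)` a `G`-lattice in `σ = π_q^{K(q)}` with degree form `Q`, one has `δ_Y = λ_Y² Q(v_Y)/|T̄_Y|`;
`3 ∤ λ_Y` for `E[3]` irreducible (Eisenstein kernels); the model identity `(q+1)Q(v_s) = #Φ_q(𝔽_{q²})·(q−1)Q(v_ns)`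
holds EXACTLY for every supercuspidal `q ≡ 2 (mod 3)` tested (`q ≤ 71`, θ of order 3, 4, 6) where all stable
lattices are homothetic (σ̄ irreducible mod 3), and for ramified principal series `q ≡ 1 (mod 3)` (`q ≤ 43`) the
two lattice classes give `ord₃(δ₁/δ_ns) = ∓1`, the class of `Λ_E` being forced to the `+1` one by level-lowering
(`ρ̄_{E,3}|_{I_q}` non-trivial unipotent) when `ρ̄_{E,3}` is surjective. So for `q ≠ 3` the law is
LEMMA-LEVEL-BY-SKETCH (write-up items W1–W4 of the memo). WHY IT MIGHT (STILL) FAIL: only at `q = 3` itself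
(Cartan level `9`, or the division side with `27 ∣ N`): there `3` divides `|T̄_s| = 6` and `|T̄_ns| = 12`, stable
lattices proliferate, and a `3` in the Manin-type constant of `f_U` is not excluded (KP Conj. 2.3); and, for
`q ≠ 3`, through the bookkeeping W4 (optimal quotients on the two-component `S`) — tested by F-R6-c. USE: R-O6-5′ →
∅ modulo the typed gaps (module docstring); after G6-8, `2 544 / 2 752` residual rows (all `679` tame, `1 865`
wild) need only lemma-level-by-sketch instances, the other `208` need a `q = 3` tier. OPEN; EVIDENCE /
conjecture item of the cell, NOT a Literature fact. -/
@[conjecture] def NonsplitTamagawaCancellationAtThree : Prop :=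
  ThreeDvdModularDegreeOfFourExact

end Summit.BirchSwinnertonDyer.Rank1Residual.AdditiveThree
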